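import Mathlib
import HarnessLib
import Summits.HubbardSuperconductivity.HubbardSuperconductivity.Theorems.KLProgrammeKLRegimeEngineTowerBlockIncrLevKit
import Summits.HubbardSuperconductivity.HubbardSuperconductivity.Theorems.KLProgrammeKLRegimeEngineTowerBlockIncrWtKitUnits

/-!
# Route `KLProgramme` — crux K3 ENGINE (stmt-HubbardSuperconductivity-20437 `KLRegimeEngineV17F2`), stub (b) v2, THE LEVELS PACKAGE (ℓ):
# instantiation (I1-dim), LEVELLED TRACKS — the born levelled arrays in the kit's LITERAL shape and divided by ANY output unit `(u, Kc)`
# (continuation of `…TowerBlockIncrLevKit` (p642896); the levelled twin of `…TowerBlockIncrWtKitUnits` (k3c3-p2 g13) / `…TowerBlockIncrWtFullKit` §units;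
#  cell gate-hubbard-kl, seat hubbard-kl-k3c2-p3 g12 as SUBSTITUTE typer while the E1 lineage is unseated — E1 / the kit-dictionary lane may rename or supersede)

`klTowerBornLev_le_kit` bounds `klTowerBornLev … d k (2(q+1)) F` (every level count `F`) by
`ε^{2q+1}·(cr·cc^{2q+1}·(Σ + tail) + cr·cc^{2q+1}·((e²)^{q+2}/2·towerFO))` for a track-blind majorant `N` of the measured levelled input sizes.  Here:

* §1 `kitBrackets_explicitFO_le_literal` — the pure-algebra step `cr·cc^{2q+1}·(S + T) + cr·cc^{2q+1}·((e²)^{q+2}/2·FO) ≤ (e⁴/2·cr)·(e²·cc)^{2q+1}·(FO + S + T)`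
  (`FO, S, T ≥ 0`): the prescribed first-order constant rides with the output-overlap constants;
* §2 **`klTowerBornLev_le_kit'`** — the literal kit shape `ε^{2q+1}·cr′·cc′^{2q+1}·(towerFO D κ² N (q+1) + Σ_{n∈Icc 2 (N₀−1)} e·Φ^{n−1}·ψ^{q+1}·towerS D τ N n (q+1) + ψ^{q+1}·tail)`,
  `cr′ = e⁴cr/2`, `cc′ = e²cc`;
* §3 **`klTowerBornLev_le_kit_units`** — for a majorant in product form `N m = (ε·Kc)·(u^m·μ m)` (`u, Kc > 0`, dimensionless `μ ≥ 0`, `μ 0 = 0`) and the guard in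
  dimensionless form: `klTowerBornLev … d k (2(q+1)) F ≤ (ε·cr′)(ε·cc′)^{2q+1}(u^{q+1}·Kc)·[towerFO D (κ²u) μ (q+1) + Σ e·Φ̂^{n−1}·ψ̂^{q+1}·towerS D (τu) μ n (q+1)
  + ψ̂^{q+1}·e·V̂·(Φ̂V̂)^{N₀−1}/(1−Φ̂V̂)]`, `Φ̂ = (eα/κ²)·(εKc)`, `ψ̂ = ψ/u`, `V̂ = towerV D (τu) μ` (k3c3-p2's `kitStep_abs_eq_units_mul`) — the `hstep` of
  `towerBorn_le_law_tracks` for a levelled track `t`, at whatever units `(u, Kc)` the instantiator assigns to `t` (LEV-UNITS-NOTE: `2^{(3p−5)J}·2^{−e(t)J}`).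
Compositions of landed theorems and real algebra; nothing about the model is asserted beyond them; nothing asserts (ℓ), any stub, K3 or superconductivity.
References: BGM 2006 §2.8 (2.83), §3 (3.2)–(3.8) [cite: BenfattoGiulianiMastropietro2006].
-/

noncomputable section

namespace Summit.HubbardSuperconductivity.HubbardSuperconductivity.Theorems.EngineV8

set_option linter.dupNamespace false -- summit = problem name (single-conjunct summit), D-0017

open Classical
open Real Finset Literature.MathematicalPhysics.QuantumLattice Literature.Probability.LatticeModels GrassmannAlgebra
open Literature.MathematicalPhysics.QuantumLattice.FermiRG
open Summit.HubbardSuperconductivity.HubbardSuperconductivity.Theorems.KLProgrammeLegKernels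
open Summit.HubbardSuperconductivity.HubbardSuperconductivity.Theorems.KLRegimeSplit
open Summit.HubbardSuperconductivity.HubbardSuperconductivity.Theorems.KLRegimeWick
open Summit.HubbardSuperconductivity.HubbardSuperconductivity.Theorems.TwoPointAssembly
open Summit.HubbardSuperconductivity.HubbardSuperconductivity.Theorems.DispersionFlow
open scoped Nat

/-! ## §1 The prescribed first-order constant rides with the overlap constants -/

/-- **Pure algebra**: for `cr, cc, FO, S, T ≥ 0`,
`cr·cc^{2q+1}·(S + T) + cr·cc^{2q+1}·((e²)^{q+2}/2·FO) ≤ (e⁴/2·cr)·(e²·cc)^{2q+1}·(FO + S + T)`. -/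
theorem kitBrackets_explicitFO_le_literal {cr cc FO S T : ℝ} (hcr : 0 ≤ cr) (hcc : 0 ≤ cc) (hFO : 0 ≤ FO) (hS : 0 ≤ S) (hT : 0 ≤ T) (q : ℕ) :
    cr * cc ^ (2 * q + 1) * (S + T) + cr * cc ^ (2 * q + 1) * (exp 2 ^ (q + 2) / 2 * FO) ≤
      (exp 4 / 2 * cr) * (exp 2 * cc) ^ (2 * q + 1) * (FO + S + T) := by
  have he2 : (1 : ℝ) ≤ exp 2 := Real.one_le_exp (by norm_num)
  have hccp : 0 ≤ cc ^ (2 * q + 1) := pow_nonneg hcc _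
  have hc1 : cr * cc ^ (2 * q + 1) ≤ (exp 4 / 2 * cr) * (exp 2 * cc) ^ (2 * q + 1) := by
    rw [mul_pow]
    have h4 : (2 : ℝ) ≤ exp 4 := by have := Real.add_one_le_exp (4 : ℝ); linarith
    have hp : (1 : ℝ) ≤ exp 2 ^ (2 * q + 1) := one_le_pow₀ he2
    calc cr * cc ^ (2 * q + 1) = 1 * cr * (1 * cc ^ (2 * q + 1)) := by ring
      _ ≤ (exp 4 / 2) * cr * (exp 2 ^ (2 * q + 1) * cc ^ (2 * q + 1)) := by
          gcongr
          · linarith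
      _ = exp 4 / 2 * cr * (exp 2 ^ (2 * q + 1) * cc ^ (2 * q + 1)) := rfl
  have hc2 : cr * cc ^ (2 * q + 1) * (exp 2 ^ (q + 2) / 2) ≤ (exp 4 / 2 * cr) * (exp 2 * cc) ^ (2 * q + 1) := by
    rw [mul_pow]
    have hpow : exp 2 ^ (q + 2) ≤ exp 4 * exp 2 ^ (2 * q + 1) := by
      have h4 : exp 4 = exp 2 ^ 2 := by rw [← Real.exp_nat_mul]; norm_num
      rw [h4, ← pow_add]
      exact pow_le_pow_right₀ he2 (by omega)
    calc cr * cc ^ (2 * q + 1) * (exp 2 ^ (q + 2) / 2) = (exp 2 ^ (q + 2)) / 2 * cr * cc ^ (2 * q + 1) := by ring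
      _ ≤ (exp 4 * exp 2 ^ (2 * q + 1)) / 2 * cr * cc ^ (2 * q + 1) := by gcongr
      _ = exp 4 / 2 * cr * (exp 2 ^ (2 * q + 1) * cc ^ (2 * q + 1)) := by ring
  calc cr * cc ^ (2 * q + 1) * (S + T) + cr * cc ^ (2 * q + 1) * (exp 2 ^ (q + 2) / 2 * FO)
      = cr * cc ^ (2 * q + 1) * (S + T) + cr * cc ^ (2 * q + 1) * (exp 2 ^ (q + 2) / 2) * FO := by ring
    _ ≤ (exp 4 / 2 * cr) * (exp 2 * cc) ^ (2 * q + 1) * (S + T) + (exp 4 / 2 * cr) * (exp 2 * cc) ^ (2 * q + 1) * FO :=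
        add_le_add (mul_le_mul_of_nonneg_right hc1 (add_nonneg hS hT)) (mul_le_mul_of_nonneg_right hc2 hFO)
    _ = (exp 4 / 2 * cr) * (exp 2 * cc) ^ (2 * q + 1) * (FO + S + T) := by ring

/-! ## §2 The born levelled arrays in the kit's literal shape -/

section Born

variable {L M : ℕ} [NeZero L] [NeZero M]

/-- **THE BORN LEVELLED ARRAYS IN THE KIT'S LITERAL SHAPE** — binders of `klTowerBornLev_le_kit`; conclusion
`klTowerBornLev … d k (2(q+1)) F ≤ ε^{2q+1}·cr′·cc′^{2q+1}·(towerFO D κ² N (q+1) + Σ + tail)`, `cr′ = e⁴cr/2`, `cc′ = e²cc`. -/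
theorem klTowerBornLev_le_kit' {β : ℝ} (hβ : 0 < β) (U μ : ℝ) (K : TrigPolyC4v) {d k : ℕ} (hd : 1 ≤ d) (hk : 1 ≤ k)
    (hZ : hubbardEffPartitionFnCT L M β U μ 0 K (klScale klE0 (d * k)) ≠ 0)
    {κ : ℝ} (hκ : 0 < κ)
    (hGB : IsGramBoundedR ((sectorSubMatrix L M β (bgmFatMultiplier L M klE0 β (nambuXiCT L μ K) (d * k - 1))).transpose *
      hubbardCovSliceCT L M β μ 0 K (klScale klE0 (d * (k + 1))) (klScale klE0 (d * k)) *
        sectorSubMatrix L M β (bgmFatMultiplier L M klE0 β (nambuXiCT L μ K) (d * k - 1))) κ)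
    {α : ℝ} (hα : 0 < α)
    (hrow : ∀ X, ∑ Y, ‖((sectorSubMatrix L M β (bgmFatMultiplier L M klE0 β (nambuXiCT L μ K) (d * k - 1))).transpose *
        hubbardCovSliceCT L M β μ 0 K (klScale klE0 (d * (k + 1))) (klScale klE0 (d * k)) *
          sectorSubMatrix L M β (bgmFatMultiplier L M klE0 β (nambuXiCT L μ K) (d * k - 1))) X Y‖ ≤ α)
    (hcol : ∀ Y, ∑ X, ‖((sectorSubMatrix L M β (bgmFatMultiplier L M klE0 β (nambuXiCT L μ K) (d * k - 1))).transpose *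
        hubbardCovSliceCT L M β μ 0 K (klScale klE0 (d * (k + 1))) (klScale klE0 (d * k)) *
          sectorSubMatrix L M β (bgmFatMultiplier L M klE0 β (nambuXiCT L μ K) (d * k - 1))) X Y‖ ≤ α)
    {ρ : ℝ} (hρ : 0 < ρ)
    {cr cc : ℝ} (hcr0 : 0 ≤ cr) (hcc0 : 0 ≤ cc)
    (hrow' : ∀ X'', ∑ X', ‖(sectorAnalysisMatrix L M β (klAnisoFamily L M β μ K klE0 (d * k)) *
        sectorSubMatrix L M β (bgmFatMultiplier L M klE0 β (nambuXiCT L μ K) (d * k - 1))) X'' X'‖ ≤ cr)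
    (hcol' : ∀ X', ∑ X'', ‖(sectorAnalysisMatrix L M β (klAnisoFamily L M β μ K klE0 (d * k)) *
        sectorSubMatrix L M β (bgmFatMultiplier L M klE0 β (nambuXiCT L μ K) (d * k - 1))) X'' X'‖ ≤ cc)
    {N₀ : ℕ} (hN₀ : 2 ≤ N₀)
    {N : ℕ → ℝ} (hN0 : ∀ m, 0 ≤ N m) (hN00 : N 0 = 0)
    (hNB : ∀ m c, (27 : ℝ) ^ c * (imagTimeWeight β M * klTowerMeasLev L M β U μ K d k (2 * m) c) ≤ N m)
    {D : ℕ} (hD : Fintype.card (SpaceTimeIdx L M × SectorLeg (sectorCount (d * k - 1))) / 2 ≤ D)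
    {τ ψ : ℝ} (hτ1 : (exp 3 * κ) ^ 2 ≤ τ) (hτ2 : (exp 2 * (κ + ρ)) ^ 2 ≤ τ) (hψ1 : κ⁻¹ ^ 2 ≤ ψ) (hψ2 : ρ⁻¹ ^ 2 ≤ ψ)
    (hguard : exp 1 * α / κ ^ 2 * towerV D τ N < 1) (q F : ℕ) :
    klTowerBornLev L M β U μ K d k (2 * (q + 1)) F ≤
      imagTimeWeight β M ^ (2 * q + 1) *
        ((exp 4 / 2 * cr) * (exp 2 * cc) ^ (2 * q + 1) *
          (towerFO D (κ ^ 2) N (q + 1) +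
            ∑ n ∈ Icc 2 (N₀ - 1), exp 1 * (exp 1 * α / κ ^ 2) ^ (n - 1) * ψ ^ (q + 1) * towerS D τ N n (q + 1) +
            ψ ^ (q + 1) * (exp 1 * towerV D τ N * (exp 1 * α / κ ^ 2 * towerV D τ N) ^ (N₀ - 1) / (1 - exp 1 * α / κ ^ 2 * towerV D τ N)))) := by
  have hε : 0 ≤ imagTimeWeight β M := imagTimeWeight_nonneg hβ.le M
  have hmain := klTowerBornLev_le_kit (L := L) (M := M) hβ U μ K hd hk hZ hκ hGB hα hrow hcol hρ hcr0 hcc0 hrow' hcol' hN₀ hN0 hN00 hNB hD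
    hτ1 hτ2 hψ1 hψ2 hguard q F
  refine hmain.trans (mul_le_mul_of_nonneg_left ?_ (pow_nonneg hε _))
  have hτ0 : 0 ≤ τ := le_trans (by positivity) hτ1
  have hψ0 : 0 ≤ ψ := le_trans (by positivity) hψ1
  have hFO0 : 0 ≤ towerFO D (κ ^ 2) N (q + 1) := towerFO_nonneg (by positivity) hN0 _
  have hS0 : 0 ≤ ∑ n ∈ Icc 2 (N₀ - 1), exp 1 * (exp 1 * α / κ ^ 2) ^ (n - 1) * ψ ^ (q + 1) * towerS D τ N n (q + 1) :=
    sum_nonneg fun n _ => by have := towerS_nonneg (D := D) hτ0 hN0 n (q + 1); positivity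
  have hT0 : 0 ≤ ψ ^ (q + 1) * (exp 1 * towerV D τ N * (exp 1 * α / κ ^ 2 * towerV D τ N) ^ (N₀ - 1) /
      (1 - exp 1 * α / κ ^ 2 * towerV D τ N)) := by
    have hV := towerV_nonneg (D := D) hτ0 hN0
    exact mul_nonneg (pow_nonneg hψ0 _) (div_nonneg (by positivity) (sub_nonneg.2 hguard.le))
  exact kitBrackets_explicitFO_le_literal hcr0 hcc0 hFO0 hS0 hT0 q

/-! ## §3 … divided by any output unit -/

/-- **THE BORN LEVELLED ARRAYS DIVIDED BY AN OUTPUT UNIT `(u, Kc)`** (any `u, Kc > 0`), for a track-blind majorant in product form `N m = (ε·Kc)·(u^m·μ m)`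
with a DIMENSIONLESS `μ ≥ 0`, `μ 0 = 0`; guard and right side in the dimensionless parameters `Φ̂ = (eα/κ²)·(ε·Kc)`, `ψ̂ = ψ/u`, `τ·u`, `κ²·u`. -/
theorem klTowerBornLev_le_kit_units {β : ℝ} (hβ : 0 < β) (U μ : ℝ) (K : TrigPolyC4v) {d k : ℕ} (hd : 1 ≤ d) (hk : 1 ≤ k)
    (hZ : hubbardEffPartitionFnCT L M β U μ 0 K (klScale klE0 (d * k)) ≠ 0)
    {κ : ℝ} (hκ : 0 < κ)
    (hGB : IsGramBoundedR ((sectorSubMatrix L M β (bgmFatMultiplier L M klE0 β (nambuXiCT L μ K) (d * k - 1))).transpose *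
      hubbardCovSliceCT L M β μ 0 K (klScale klE0 (d * (k + 1))) (klScale klE0 (d * k)) *
        sectorSubMatrix L M β (bgmFatMultiplier L M klE0 β (nambuXiCT L μ K) (d * k - 1))) κ)
    {α : ℝ} (hα : 0 < α)
    (hrow : ∀ X, ∑ Y, ‖((sectorSubMatrix L M β (bgmFatMultiplier L M klE0 β (nambuXiCT L μ K) (d * k - 1))).transpose *
        hubbardCovSliceCT L M β μ 0 K (klScale klE0 (d * (k + 1))) (klScale klE0 (d * k)) *
          sectorSubMatrix L M β (bgmFatMultiplier L M klE0 β (nambuXiCT L μ K) (d * k - 1))) X Y‖ ≤ α)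
    (hcol : ∀ Y, ∑ X, ‖((sectorSubMatrix L M β (bgmFatMultiplier L M klE0 β (nambuXiCT L μ K) (d * k - 1))).transpose *
        hubbardCovSliceCT L M β μ 0 K (klScale klE0 (d * (k + 1))) (klScale klE0 (d * k)) *
          sectorSubMatrix L M β (bgmFatMultiplier L M klE0 β (nambuXiCT L μ K) (d * k - 1))) X Y‖ ≤ α)
    {ρ : ℝ} (hρ : 0 < ρ)
    {cr cc : ℝ} (hcr0 : 0 ≤ cr) (hcc0 : 0 ≤ cc)
    (hrow' : ∀ X'', ∑ X', ‖(sectorAnalysisMatrix L M β (klAnisoFamily L M β μ K klE0 (d * k)) *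
        sectorSubMatrix L M β (bgmFatMultiplier L M klE0 β (nambuXiCT L μ K) (d * k - 1))) X'' X'‖ ≤ cr)
    (hcol' : ∀ X', ∑ X'', ‖(sectorAnalysisMatrix L M β (klAnisoFamily L M β μ K klE0 (d * k)) *
        sectorSubMatrix L M β (bgmFatMultiplier L M klE0 β (nambuXiCT L μ K) (d * k - 1))) X'' X'‖ ≤ cc)
    {N₀ : ℕ} (hN₀ : 2 ≤ N₀)
    {u Kc : ℝ} (hu : 0 < u) (hKc : 0 < Kc) {μd : ℕ → ℝ} (hμ0 : ∀ m, 0 ≤ μd m) (hμ00 : μd 0 = 0)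
    (hNB : ∀ m c, (27 : ℝ) ^ c * (imagTimeWeight β M * klTowerMeasLev L M β U μ K d k (2 * m) c) ≤ (imagTimeWeight β M * Kc) * (u ^ m * μd m))
    {D : ℕ} (hD : Fintype.card (SpaceTimeIdx L M × SectorLeg (sectorCount (d * k - 1))) / 2 ≤ D)
    {τ ψ : ℝ} (hτ1 : (exp 3 * κ) ^ 2 ≤ τ) (hτ2 : (exp 2 * (κ + ρ)) ^ 2 ≤ τ) (hψ1 : κ⁻¹ ^ 2 ≤ ψ) (hψ2 : ρ⁻¹ ^ 2 ≤ ψ)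
    (hguard : exp 1 * α / κ ^ 2 * (imagTimeWeight β M * Kc) * towerV D (τ * u) μd < 1) (q F : ℕ) :
    klTowerBornLev L M β U μ K d k (2 * (q + 1)) F ≤
      (imagTimeWeight β M * (exp 4 / 2 * cr)) * (imagTimeWeight β M * (exp 2 * cc)) ^ (2 * q + 1) * (u ^ (q + 1) * Kc) *
        (towerFO D (κ ^ 2 * u) μd (q + 1) +
          ∑ n ∈ Icc 2 (N₀ - 1), exp 1 * (exp 1 * α / κ ^ 2 * (imagTimeWeight β M * Kc)) ^ (n - 1) * (ψ / u) ^ (q + 1) * towerS D (τ * u) μd n (q + 1) +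
          (ψ / u) ^ (q + 1) * exp 1 * towerV D (τ * u) μd * (exp 1 * α / κ ^ 2 * (imagTimeWeight β M * Kc) * towerV D (τ * u) μd) ^ (N₀ - 1) /
            (1 - exp 1 * α / κ ^ 2 * (imagTimeWeight β M * Kc) * towerV D (τ * u) μd)) := by
  have hε : 0 < imagTimeWeight β M := imagTimeWeight_pos_of_pos (M := M) hβ
  have hN0 : ∀ m, 0 ≤ (imagTimeWeight β M * Kc) * (u ^ m * μd m) := fun m => by have := hμ0 m; positivity
  have hN00 : (imagTimeWeight β M * Kc) * (u ^ 0 * μd 0) = 0 := by rw [hμ00]; ring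
  have hV : towerV D τ (fun m => (imagTimeWeight β M * Kc) * (u ^ m * μd m)) = (imagTimeWeight β M * Kc) * towerV D (τ * u) μd :=
    towerV_units D τ _ u μd
  have hguard' : exp 1 * α / κ ^ 2 * towerV D τ (fun m => (imagTimeWeight β M * Kc) * (u ^ m * μd m)) < 1 := by
    rw [hV, ← mul_assoc]; exact hguard
  have h := klTowerBornLev_le_kit' (L := L) (M := M) hβ U μ K hd hk hZ hκ hGB hα hrow hcol hρ hcr0 hcc0 hrow' hcol' hN₀
    (N := fun m => (imagTimeWeight β M * Kc) * (u ^ m * μd m)) hN0 hN00 hNB hD hτ1 hτ2 hψ1 hψ2 hguard' q F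
  have hk := kitStep_abs_eq_units_mul (K := imagTimeWeight β M * Kc) (u := u) (mul_ne_zero hε.ne' hKc.ne') hu.ne' D (κ ^ 2) τ
    (exp 1 * α / κ ^ 2) ψ μd (N₀ - 1) (q + 1)
  refine h.trans (le_of_eq ?_)
  rw [show ψ ^ (q + 1) * (exp 1 * towerV D τ (fun m => imagTimeWeight β M * Kc * (u ^ m * μd m)) *
        (exp 1 * α / κ ^ 2 * towerV D τ (fun m => imagTimeWeight β M * Kc * (u ^ m * μd m))) ^ (N₀ - 1) /
        (1 - exp 1 * α / κ ^ 2 * towerV D τ (fun m => imagTimeWeight β M * Kc * (u ^ m * μd m)))) =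
      ψ ^ (q + 1) * exp 1 * towerV D τ (fun m => imagTimeWeight β M * Kc * (u ^ m * μd m)) *
        (exp 1 * α / κ ^ 2 * towerV D τ (fun m => imagTimeWeight β M * Kc * (u ^ m * μd m))) ^ (N₀ - 1) /
        (1 - exp 1 * α / κ ^ 2 * towerV D τ (fun m => imagTimeWeight β M * Kc * (u ^ m * μd m))) by ring, hk]
  ring

end Born

end Summit.HubbardSuperconductivity.HubbardSuperconductivity.Theorems.EngineV8

end
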